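import Summits.QuantumFields.YangMills.Theorems.BalabanUVNodesN21GappedTopReading13CoPH
import Summits.QuantumFields.YangMills.Theorems.BalabanUVNodesN20KeyedRelWeightSocketAtRecord13CoPH

/-!
# N21 (NE7c) · THE GAPPED ROAD COSTS N20 NOTHING BELOW THE TOP: the bad-class sums of the top-lettered ∕ gapped class weights are LETTER-FREE — `RelWeightBound` at the
# gapped carriers `gapWeightA∕B₁₃ … ρ n` does not depend on the dials `(ρ, n)` (so equals N20's face at the `ε`-lettered PRE-𝐑 top terms, `ρ ≡ 0`), for every persistence
# policy cutting strictly below the top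

R134 seat `pub-ymgap-dag-n21-d` (g12, lane owner N21), strategy s2; key K3⁸ `SpineGivenEndpointR13SepCoPHV` = stmt-QuantumFields-27366, `--kind proof --supports 27366 --as helper`;
COUNT-NEUTRAL.  Theorems only (0 `def`).  Imports U6 `…N21GappedTopReading13CoPH` (p622874: `gapWeightA∕B₁₃`, `sum_classSet₁₃_gapWeight{A,B}₁₃(_eq_schemeZ)`) and through it
U5∕R1∕T1∕T2 (`topTermAtLevel`, `topClassWeightAt`, `topSlotAt`, `wTopAt`, `isStepUnity_wTopAt`, `integrable_topPiece`), def-T FILE 19 (`isRT_tstepOfRecordAt`, `tstepOfRecordAt_apply`),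
dag-n20-d's reading (`keyA₁₃ ∕ keyB₁₃ ∕ classSet₁₃ ∕ badClass₁₃`), node U5d's keys (`keyOldLargeField_twoRunKeyA_iff ∕ _twoRunKeyB_iff`, `Seq.init_Λ`); and dag-n20-w1's
`…N20KeyedRelWeightSocketAtRecord13CoPH` (p588277: `keyA₁₃∕keyB₁₃_mem_classSet₁₃`, `keyA₁₃∕keyB₁₃_mem_badClass₁₃_iff` BY NAME — not re-declared).  [III] = [Balaban1988Convergent],
[LF-I∕II] = [Balaban1989LargeFieldI∕II].

WHY.  On the gapped road (U1–U8, V1 `…N21GappedRoadK3V6Knit`) the K3⁸ faces N21 and N27x are theorems and the item follows from K4 + N20 + N19′ AT THE GAPPED OBJECTS.  The plan's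
question for N20 (NE7b, `RelWeightBound` of the persistence class `badClass₁₃ θ K₀ g₀ jcut` = «a large-field region born at a level `≤ jcut K` is still in the index»,
[LF-II] (1.80) p.384) is whether re-lettering the top step moves N20's target.  It does NOT: membership of a key in the bad class reads the history's entries at levels
`≤ jcut K` (run A) ∕ `≤ jcut K + 1` (run B, block-down key), i.e. STRICTLY BELOW THE TOP whenever `jcut K < K₀ + K`; and for every class of histories determined below the top,
the sum of the top-lettered terms over the class is the sum of the record's level-`(K−1)` pieces over the class — def-T's unity of the top 𝐓-step at ANY letter + the RT
identity of the transport, FIBREWISE over the prefixes (the masked-family instance of `isRT_tstepOfRecordAt`).  Hence the bad-class sums (and the totals, E1) of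
`gapWeightA∕B₁₃ … ρ n` are the same numbers for every `(ρ, n)`, and `RelWeightBound` at the gapped carriers is ONE statement for all dials — equal to its `ρ ≡ 0` instance,
the `ε`-lettered PRE-𝐑 top terms.  (The record's own weights `weightA∕B₁₃` are the POST-𝐑 top terms: they differ from the `ρ ≡ 0` instance by the top 𝐑-step of record,
which redistributes slot mass along the live selector — LOCATED, as for every file on this road since T1; not touched here.)

WHAT IS PROVED (kernel; [bookkeeping]; NO estimate).
§47 (run-generic, top step `k + 1 = p.K`) `tstepOfRecordAt_mask` (the 𝐓-step at letters of a masked family is the masked 𝐓-step) · ★★ `sum_fiber_topClassWeightAt_eq` (FIBREWISE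
  E1-step: `Σ_{s′ : init s′ = s} topClassWeight^{θ}(s′) = classWeight_k(s)` for EVERY letter — rows (H-ζ), `Σ|ζ| ≤ 1`, `Σζ = 1`, (e1) at level `k`) · ★★ `sum_filter_topClassWeightAt_letter_free`
  (for a class of top histories DETERMINED BELOW THE TOP, the class sum of the top-lettered terms is the same for every letter) · `sum_filter_topTermAtLevel_letter_free` (level form
  `j = p.K`, the level-`0` case trivial).
§48 (at the `CoPH`-keyed Stage-13 record, rows `hsel` + (H-ζ)) `keyA₁₃_mem_badClass₁₃_iff_exists` ∕ `keyB₁₃_mem_badClass₁₃_iff_exists` (bad membership reads the levels `≤ jcut K (+1)`)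
  · `sum_badClass₁₃_gapWeight{A,B}₁₃_eq_sum_filter` · `keyA₁₃∕keyB₁₃_mem_badClass₁₃_determined`
  · ★★★ `sum_badClass₁₃_gapWeightA₁₃_letter_free` ∕ `…B…` (`jcut K < K₀ + K ∨ jcut K = 0`: the bad-class sums of the gapped weights do not depend on `(ρ, n)`) · ★★★
  `relWeightBound_gapCarriers_iff` (for policies with `jcut K < K₀ + K ∨ jcut K = 0`: `RelWeightBound 1 (classSet₁₃ …) (gapWeightA₁₃ … ρ n) (gapWeightB₁₃ … ρ n) (badClass₁₃ … jcut) W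
  ↔` the same at `(ρ′, n′)`, every `W`).

HONEST FRAMING (binding).  Bookkeeping BY NAME over def-T's unity∕RT and node U5d's keys; NO estimate of Bałaban's; NE7b ∕ NE7c NOT PRINTED for `d = 4` ∕ NOT proved; N20's
face itself is NOT proved here (only its invariance along this seat's dials); the comparison with n20-d's POST-𝐑 reading of record is NOT made (top 𝐑-step, LOCATED); no
`Provisos₁₃CoPH` inhabitant claimed (K0⁷ OPEN); N20 ∕ N21 NOT discharged; K3⁸ NOT claimed; counts UNMOVED (typed 28∕28 · discharged 5∕27); never a count claim.  No `sorry`,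
no `def`, no `instance`, no `notation`; standard axioms.  One finite four-torus programme at fixed `ε` — NOT ℝ⁴, NOT OS, NOT a mass gap, NOT the Clay problem.
-/

set_option autoImplicit false

noncomputable section

open scoped BigOperators
open Finset MeasureTheory

namespace Summit.QuantumFields.YangMills.Theorems.N21ShellSplitOfRecord13CoPH

open Literature.MathematicalPhysics.QuantumFieldTheory.Balaban1983to89
open Literature.MathematicalPhysics.QuantumFieldTheory.Balaban1983to89.T4Continuum
open Literature.MathematicalPhysics.QuantumFieldTheory.Balaban1983to89.Node00
open B14.Eq218Concrete
open YMDAG.UVSplit (SpineReading₁₃CoPH keyA₁₃ keyB₁₃ keyB₁₃_eq runA₁₃ runB₁₃ histA₁₃ histB₁₃ histA₁₃_zero histB₁₃_zero classSet₁₃ badClass₁₃)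
open T4WeightBudget (RelWeightBound)
open Summit.QuantumFields.YangMills.Theorems.N21StepWeightsPositivity (zetaOfRecord_nonneg)
open Summit.QuantumFields.YangMills.BalabanUVNodes.N20KeyedRelWeightSocketAtRecord13CoPH (keyA₁₃_mem_classSet₁₃ keyB₁₃_mem_classSet₁₃ keyA₁₃_mem_badClass₁₃_iff
  keyB₁₃_mem_badClass₁₃_iff)

/-! ## §47 Run-generic: the masked 𝐓-step, the FIBREWISE E1-step, letter-freeness of class sums determined below the top -/

section Fibre

variable (F : T4Family) (N : ℕ) [NeZero N] (ϑ : Stage9Params F N) (D : FiniteEpsData F (SU N)) (g₀ : ℕ → ℝ) (os : List (ULoop F))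
  (p : B12.RunParams) (g : ℕ → ℝ) (k : ℕ)

/-- **The 𝐓-step at letters of a MASKED family is the masked 𝐓-step**: masking the level-`k` input by a predicate `P` on level-`k` histories multiplies the stepped slot of `s′` by
`[P (init s′)]` (def-T `tstepOfRecordAt_apply`: the step reads the input only at `init s′`; the transport of `0` is `0`). [bookkeeping] -/
theorem tstepOfRecordAt_mask (Θ : ThresholdLetter) (w : StepWeightsOfRecord F N ϑ.ν ϑ.τ9.M)
    (T : SeqOfRecord F ϑ.ν ϑ.τ9.M g p.K k → GaugeField (F.P p.K) k (SU N) → ℝ) (P : SeqOfRecord F ϑ.ν ϑ.τ9.M g p.K k → Prop) [DecidablePred P]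
    (s' : SeqOfRecord F ϑ.ν ϑ.τ9.M g p.K (k + 1)) (V : GaugeField (F.P p.K) (k + 1) (SU N)) :
    tstepOfRecordAt F N ϑ.ν ϑ.τ9.M Θ w p g k (fun s U => if P s then T s U else 0) s' V =
      if P s'.init then tstepOfRecordAt F N ϑ.ν ϑ.τ9.M Θ w p g k T s' V else 0 := by
  rw [tstepOfRecordAt_apply, tstepOfRecordAt_apply]
  by_cases h : P s'.init
  · simp only [h, if_true]
  · simp only [h, if_false, mul_zero]
    show (_ : ℝ) * ∫ _, (0 : ℝ) ∂_ = 0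
    simp

/-- ★★ **FIBREWISE E1-STEP FOR THE TOP-LETTERED TERMS** (`k + 1 = p.K`): for EVERY letter `θ` and every level-`k` history `s`, the top-lettered terms of the continuations of `s`
re-sum to the record's level-`k` piece of `s`: `Σ_{s′ : init s′ = s} topClassWeight^{θ}(s′) = classWeight_k(s)` — def-T's unity of the top 𝐓-step at the letter + the RT identity of
the transport, applied to the family masked at `s` (T2's `sum_topClassWeightAt_eq` is the sum of these over `s`).  Rows: (H-ζ), `Σ|ζ| ≤ 1`, `Σζ = 1`, (e1) at level `k`. [bookkeeping] -/
theorem sum_fiber_topClassWeightAt_eq [DecidableEq (SeqOfRecord F ϑ.ν ϑ.τ9.M g p.K k)] (hk : k + 1 = p.K) (hζm : ZetaMeasurable F N ϑ.ζ) (hζ1 : IsZetaAbsLeOne F N ϑ.ν ϑ.τ9.M ϑ.ζ)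
    (hζu : IsZetaUnity F N ϑ.ν ϑ.τ9.M ϑ.ζ) (θ t : ℝ)
    (hint : ∀ s : SeqOfRecord F ϑ.ν ϑ.τ9.M g p.K k,
      Integrable (fun U => chiSeqOfRecord F N ϑ.ν ϑ.τ9.M g p.K k s U * dressedSlotsOfDatum₉ F N ϑ D g₀ os t p g k s U) (fieldMeasure (F.P p.K) k (SU N)))
    (s : SeqOfRecord F ϑ.ν ϑ.τ9.M g p.K k) :
    ∑ s' ∈ univ.filter (fun s' : SeqOfRecord F ϑ.ν ϑ.τ9.M g p.K (k + 1) => s'.init = s), topClassWeightAt F N ϑ D g₀ os p g k θ t s' =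
      classWeightOfDatum₉ F N ϑ D g₀ os p g k t s := by
  classical
  have hk' : k < p.K := by omega
  have hlow := chiSeqOfRecordAt_topLetter_of_lt F N ϑ p g k hk' θ
  have htop : topLetter ϑ.ν θ p g (k + 1) = θ := by rw [hk]; exact topLetter_top ϑ.ν θ p g
  -- the dressed level-`k` family MASKED at `s`
  set T : SeqOfRecord F ϑ.ν ϑ.τ9.M g p.K k → GaugeField (F.P p.K) k (SU N) → ℝ :=
    fun s₀ U => if s₀ = s then dressedSlotsOfDatum₉ F N ϑ D g₀ os t p g k s₀ U else 0 with hT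
  have hintT : ∀ s₀ : SeqOfRecord F ϑ.ν ϑ.τ9.M g p.K k,
      Integrable (fun U => chiSeqOfRecordAt F N ϑ.ν ϑ.τ9.M g p.K k (topLetter ϑ.ν θ p g k) s₀ U * T s₀ U) (fieldMeasure (F.P p.K) k (SU N)) := by
    intro s₀
    rw [hlow]
    by_cases h : s₀ = s
    · simp only [hT, h, if_true]; exact hint s
    · simp only [hT, h, if_false, mul_zero]; exact integrable_zero _ _ _
  have hRT := isRT_tstepOfRecordAt F N ϑ.ν ϑ.τ9.M (topLetter ϑ.ν θ) (wTopAt F N ϑ θ) p g k hk' T hintT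
    (fun s' => measurable_wTopAt F N ϑ p g k hζm θ s') (fun s' U V' => abs_wTopAt_le_one F N ϑ p g k hζ1 θ s' U V')
    (fun s' => measurable_chiSeqOfRecordAt_of_localBg (localBgMeasurable F N ϑ.ν) ϑ.τ9.M g p.K (k + 1) _ s') (isStepUnity_wTopAt F N ϑ p g k hζu θ)
  have h1 := hRT (fun _ => 1) measurable_const ⟨1, fun _ => by simp⟩
  simp only [mul_one, hlow, htop] at h1
  -- the coarse side: masked stepped slots = the top-lettered slots of the continuations of `s`
  have hmask : ∀ (s' : SeqOfRecord F ϑ.ν ϑ.τ9.M g p.K (k + 1)) (V : GaugeField (F.P p.K) (k + 1) (SU N)),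
      tstepOfRecordAt F N ϑ.ν ϑ.τ9.M (topLetter ϑ.ν θ) (wTopAt F N ϑ θ) p g k T s' V =
        if s'.init = s then topSlotAt F N ϑ D g₀ os p g k θ t s' V else 0 := by
    intro s' V
    rw [hT, tstepOfRecordAt_mask]
    rfl
  have hcoarse : ∀ V : GaugeField (F.P p.K) (k + 1) (SU N),
      ∑ s', chiSeqOfRecordAt F N ϑ.ν ϑ.τ9.M g p.K (k + 1) θ s' V * tstepOfRecordAt F N ϑ.ν ϑ.τ9.M (topLetter ϑ.ν θ) (wTopAt F N ϑ θ) p g k T s' V =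
        ∑ s' ∈ univ.filter (fun s' : SeqOfRecord F ϑ.ν ϑ.τ9.M g p.K (k + 1) => s'.init = s),
          chiSeqOfRecordAt F N ϑ.ν ϑ.τ9.M g p.K (k + 1) θ s' V * topSlotAt F N ϑ D g₀ os p g k θ t s' V := by
    intro V
    rw [Finset.sum_filter]
    refine Finset.sum_congr rfl fun s' _ => ?_
    rw [hmask]
    split_ifs <;> simp
  -- the fine side: the masked family picks out `s`
  have hfine : ∀ U : GaugeField (F.P p.K) k (SU N),
      ∑ s₀, chiSeqOfRecord F N ϑ.ν ϑ.τ9.M g p.K k s₀ U * T s₀ U =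
        chiSeqOfRecord F N ϑ.ν ϑ.τ9.M g p.K k s U * dressedSlotsOfDatum₉ F N ϑ D g₀ os t p g k s U := by
    intro U
    rw [Finset.sum_eq_single s]
    · simp only [hT, if_true]
    · intro s₀ _ hs₀; simp only [hT, hs₀, if_false, mul_zero]
    · intro h; exact absurd (Finset.mem_univ s) h
  simp_rw [hcoarse, hfine] at h1
  unfold topClassWeightAt classWeightOfDatum₉
  rw [← integral_finsetSum _ fun s' _ => integrable_topPiece F N ϑ D g₀ os p g k hk' hζm hζ1 θ θ t hint s']
  exact h1

/-- ★★ **LETTER-FREENESS OF CLASS SUMS DETERMINED BELOW THE TOP** (`k + 1 = p.K`): if a class `R` of top histories is determined by their prefixes (`init s′₁ = init s′₂ ⇒ (R s′₁ ↔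
R s′₂)`), then `Σ_{s′ : R s′} topClassWeight^{θ}(s′)` is the same number for every letter `θ` (both equal the sum of the record's level-`k` pieces over the prefixes continuing
into `R`). Rows as in `sum_fiber_topClassWeightAt_eq`. [bookkeeping] -/
theorem sum_filter_topClassWeightAt_letter_free (hk : k + 1 = p.K) (hζm : ZetaMeasurable F N ϑ.ζ) (hζ1 : IsZetaAbsLeOne F N ϑ.ν ϑ.τ9.M ϑ.ζ)
    (hζu : IsZetaUnity F N ϑ.ν ϑ.τ9.M ϑ.ζ) (t : ℝ)
    (hint : ∀ s : SeqOfRecord F ϑ.ν ϑ.τ9.M g p.K k,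
      Integrable (fun U => chiSeqOfRecord F N ϑ.ν ϑ.τ9.M g p.K k s U * dressedSlotsOfDatum₉ F N ϑ D g₀ os t p g k s U) (fieldMeasure (F.P p.K) k (SU N)))
    (R : SeqOfRecord F ϑ.ν ϑ.τ9.M g p.K (k + 1) → Prop) [DecidablePred R]
    (hR : ∀ s₁ s₂ : SeqOfRecord F ϑ.ν ϑ.τ9.M g p.K (k + 1), s₁.init = s₂.init → (R s₁ ↔ R s₂)) (θ₁ θ₂ : ℝ) :
    ∑ s' ∈ univ.filter R, topClassWeightAt F N ϑ D g₀ os p g k θ₁ t s' = ∑ s' ∈ univ.filter R, topClassWeightAt F N ϑ D g₀ os p g k θ₂ t s' := by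
  classical
  -- both sides equal `Σ_s [Q s] · classWeight_k(s)` with `Q s := ∃ s′, init s′ = s ∧ R s′`
  suffices h : ∀ θ : ℝ, ∑ s' ∈ univ.filter R, topClassWeightAt F N ϑ D g₀ os p g k θ t s' =
      ∑ s : SeqOfRecord F ϑ.ν ϑ.τ9.M g p.K k, if (∃ s' : SeqOfRecord F ϑ.ν ϑ.τ9.M g p.K (k + 1), s'.init = s ∧ R s') then
        classWeightOfDatum₉ F N ϑ D g₀ os p g k t s else 0 by
    rw [h θ₁, h θ₂]
  intro θ
  rw [Finset.sum_filter, Seq.sum_seq_succ_fiber]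
  refine Finset.sum_congr rfl fun s _ => ?_
  by_cases hQ : ∃ s' : SeqOfRecord F ϑ.ν ϑ.τ9.M g p.K (k + 1), s'.init = s ∧ R s'
  · rw [if_pos hQ, ← sum_fiber_topClassWeightAt_eq F N ϑ D g₀ os p g k hk hζm hζ1 hζu θ t hint s]
    refine Finset.sum_congr rfl fun s' hs' => ?_
    obtain ⟨s'', hs'', hR''⟩ := hQ
    have hs'i : s'.init = s := (Finset.mem_filter.1 hs').2
    rw [if_pos ((hR s'' s' (hs''.trans hs'i.symm)).1 hR'')]
  · rw [if_neg hQ]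
    refine Finset.sum_eq_zero fun s' hs' => ?_
    have hs'i : s'.init = s := (Finset.mem_filter.1 hs').2
    rw [if_neg fun h => hQ ⟨s', hs'i, h⟩]

/-- **LEVEL FORM** (`j = p.K`): for a class `R` of level-`j` histories of the run determined by the entries STRICTLY BELOW `j` (window agreement on `1 ≤ i < j` of the `Λ`- and
`Ω`-entries decides `R` — asked only for `0 < j`), `Σ_{s : R s} topTerm^{θ}_j(s)` is the same for every letter — at `j = 0` there is no top step and nothing to prove.
[bookkeeping] -/
theorem sum_filter_topTermAtLevel_letter_free (hζm : ZetaMeasurable F N ϑ.ζ) (hζ1 : IsZetaAbsLeOne F N ϑ.ν ϑ.τ9.M ϑ.ζ) (hζu : IsZetaUnity F N ϑ.ν ϑ.τ9.M ϑ.ζ) (t : ℝ)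
    (hint : ∀ k, k < p.K → ∀ s : SeqOfRecord F ϑ.ν ϑ.τ9.M g p.K k,
      Integrable (fun U => chiSeqOfRecord F N ϑ.ν ϑ.τ9.M g p.K k s U * dressedSlotsOfDatum₉ F N ϑ D g₀ os t p g k s U) (fieldMeasure (F.P p.K) k (SU N))) :
    ∀ (j : ℕ), j = p.K → ∀ (R : SeqOfRecord F ϑ.ν ϑ.τ9.M g p.K j → Prop) [DecidablePred R],
      (0 < j → ∀ s₁ s₂ : SeqOfRecord F ϑ.ν ϑ.τ9.M g p.K j, (∀ i, 1 ≤ i → i < j → s₁.Λ i = s₂.Λ i ∧ s₁.Ω i = s₂.Ω i) → (R s₁ ↔ R s₂)) →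
      ∀ θ₁ θ₂ : ℝ, ∑ s ∈ univ.filter R, topTermAtLevel F N ϑ D g₀ os p g θ₁ t j s = ∑ s ∈ univ.filter R, topTermAtLevel F N ϑ D g₀ os p g θ₂ t j s := by
  intro j hj R _ hR θ₁ θ₂
  cases j with
  | zero => simp only [topTermAtLevel_zero]
  | succ k =>
    simp only [topTermAtLevel_succ]
    refine sum_filter_topClassWeightAt_letter_free F N ϑ D g₀ os p g k hj hζm hζ1 hζu t (hint k (by omega)) R
      (fun s₁ s₂ h => hR (Nat.succ_pos k) s₁ s₂ ?_) θ₁ θ₂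
    intro i h1 hi
    have hik : i ≤ k := by omega
    exact ⟨by rw [← Seq.init_Λ s₁ h1 hik, ← Seq.init_Λ s₂ h1 hik, h], by rw [← Seq.init_Ω s₁ h1 hik, ← Seq.init_Ω s₂ h1 hik, h]⟩

end Fibre

/-! ## §48 At the `CoPH`-keyed Stage-13 record: bad membership reads the levels below the top; the bad-class sums of the gapped weights are dial-free; `RelWeightBound` too -/

section Record

variable {F : T4Family} {N : ℕ} [NeZero N] (θ : Stage13HParams F N) (hP : θ.Provisos₁₃CoPH F N) (K₀ : ℕ) (g₀ : ℕ → ℝ) (os : List (ULoop F)) (jcut : ℕ → ℕ)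

/-- **RUN A: BAD MEMBERSHIP READS THE LEVELS `≤ jcut K`** — the key of `s` is in the persistence class iff `Λ_j(s) ≠ 𝕋` for some `1 ≤ j ≤ jcut K` (dag-n20-w1's
`keyA₁₃_mem_badClass₁₃_iff` + node U5d's `keyOldLargeField_twoRunKeyA_iff`). [bookkeeping] -/
theorem keyA₁₃_mem_badClass₁₃_iff_exists (K : ℕ) (t : ℝ) (s : SeqOfRecord F θ.ν θ.τ9.M (histA₁₃ θ K₀ g₀ K) (K₀ + K) (K₀ + K)) :
    keyA₁₃ θ K₀ g₀ K s ∈ badClass₁₃ θ K₀ g₀ jcut K t ↔ ∃ j, 1 ≤ j ∧ j ≤ jcut K ∧ s.Λ j ≠ Set.univ :=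
  (keyA₁₃_mem_badClass₁₃_iff θ K₀ g₀ jcut K t s).trans (keyOldLargeField_twoRunKeyA_iff F θ.ν θ.τ9.M _ _ _ (jcut K) s)

/-- **RUN B: BAD MEMBERSHIP READS THE LEVELS `≤ jcut K + 1`** (`0 < M`, `jcut K ≤ K₀ + K`) — the block-down key of `s′` is in the persistence class iff the block-down
image of some `Λ_{j+1}(s′)`, `1 ≤ j ≤ jcut K`, is not the whole cutoff-`(K₀+K)` torus (dag-n20-w1's `keyB₁₃_mem_badClass₁₃_iff` + node U5d's `keyOldLargeField_twoRunKeyB_iff`).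
[bookkeeping] -/
theorem keyB₁₃_mem_badClass₁₃_iff_exists (hM : 0 < θ.τ9.M) (K : ℕ) (t : ℝ) (hj : jcut K ≤ K₀ + K)
    (s' : SeqOfRecord F θ.ν θ.τ9.M (histB₁₃ θ K₀ g₀ K) (K₀ + K + 1) (K₀ + K + 1)) :
    keyB₁₃ θ K₀ g₀ K s' ∈ badClass₁₃ θ K₀ g₀ jcut K t ↔ ∃ j, 1 ≤ j ∧ j ≤ jcut K ∧ blockDownSet F (K₀ + K) (s'.Λ (j + 1)) ≠ Set.univ := by
  rw [keyB₁₃_mem_badClass₁₃_iff θ K₀ g₀ jcut K t s', keyB₁₃_eq θ K₀ g₀ hM K s']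
  exact keyOldLargeField_twoRunKeyB_iff F θ.ν hM _ _ _ hj s'

/-- run A: the bad-class sum of the gapped weights is the sum of the top-lettered terms (selected middle letter) over the histories keyed into the bad class (the filter read
with the reading's own classical key decidability). [bookkeeping] -/
theorem sum_badClass₁₃_gapWeightA₁₃_eq_sum_filter (ρ : ℕ → ℝ) (n : ℕ → ℕ) (K : ℕ) (t : ℝ) :
    ∑ x ∈ badClass₁₃ θ K₀ g₀ jcut K t, gapWeightA₁₃ θ hP K₀ g₀ os ρ n K t x =
      letI : ∀ Kc, DecidableEq (SiteSeqKey F Kc) := fun _ => Classical.decEq _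
      ∑ s ∈ univ.filter (fun s => keyA₁₃ θ K₀ g₀ K s ∈ badClass₁₃ θ K₀ g₀ jcut K t),
        topTermAtLevel F N θ.toStage9Params (datumOfRecord₁₃CoPH F N θ hP) g₀ os (runA₁₃ F K₀ g₀ K) (histA₁₃ θ K₀ g₀ K)
          (cutGrid θ.ν (histA₁₃ θ K₀ g₀ K) (K₀ + K) (ρ K) (selGapDepth₁₃ θ hP K₀ g₀ os ρ (n K) K t + 1)) t (K₀ + K) s := by
  letI : ∀ Kc, DecidableEq (SiteSeqKey F Kc) := fun _ => Classical.decEq _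
  unfold gapWeightA₁₃
  have hmaps : ∀ s ∈ univ.filter (fun s => keyA₁₃ θ K₀ g₀ K s ∈ badClass₁₃ θ K₀ g₀ jcut K t), keyA₁₃ θ K₀ g₀ K s ∈ badClass₁₃ θ K₀ g₀ jcut K t :=
    fun s hs => (Finset.mem_filter.1 hs).2
  rw [← Finset.sum_fiberwise_of_maps_to hmaps]
  refine Finset.sum_congr rfl fun x hx => Finset.sum_congr ?_ fun _ _ => rfl
  ext s
  simp only [Finset.mem_filter, Finset.mem_univ, true_and]
  exact ⟨fun h => ⟨h ▸ hx, h⟩, fun h => h.2⟩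

/-- run B: the same along `keyB₁₃`. [bookkeeping] -/
theorem sum_badClass₁₃_gapWeightB₁₃_eq_sum_filter (ρ : ℕ → ℝ) (n : ℕ → ℕ) (K : ℕ) (t : ℝ) :
    ∑ x ∈ badClass₁₃ θ K₀ g₀ jcut K t, gapWeightB₁₃ θ hP K₀ g₀ os ρ n K t x =
      letI : ∀ Kc, DecidableEq (SiteSeqKey F Kc) := fun _ => Classical.decEq _
      ∑ s' ∈ univ.filter (fun s' => keyB₁₃ θ K₀ g₀ K s' ∈ badClass₁₃ θ K₀ g₀ jcut K t),
        topTermAtLevel F N θ.toStage9Params (datumOfRecord₁₃CoPH F N θ hP) g₀ os (runB₁₃ F K₀ g₀ K) (histB₁₃ θ K₀ g₀ K)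
          (cutGrid θ.ν (histB₁₃ θ K₀ g₀ K) (K₀ + K + 1) (ρ K) (selGapDepth₁₃ θ hP K₀ g₀ os ρ (n K) K t + 1)) t (K₀ + K + 1) s' := by
  letI : ∀ Kc, DecidableEq (SiteSeqKey F Kc) := fun _ => Classical.decEq _
  unfold gapWeightB₁₃
  have hmaps : ∀ s' ∈ univ.filter (fun s' => keyB₁₃ θ K₀ g₀ K s' ∈ badClass₁₃ θ K₀ g₀ jcut K t), keyB₁₃ θ K₀ g₀ K s' ∈ badClass₁₃ θ K₀ g₀ jcut K t :=
    fun s' hs' => (Finset.mem_filter.1 hs').2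
  rw [← Finset.sum_fiberwise_of_maps_to hmaps]
  refine Finset.sum_congr rfl fun x hx => Finset.sum_congr ?_ fun _ _ => rfl
  ext s'
  simp only [Finset.mem_filter, Finset.mem_univ, true_and]
  exact ⟨fun h => ⟨h ▸ hx, h⟩, fun h => h.2⟩

/-- run A: for a policy cutting STRICTLY BELOW THE TOP (`jcut K < K₀ + K`; or not cutting at all, `jcut K = 0`), bad membership of `keyA₁₃ … s` is DETERMINED BELOW THE TOP.
[bookkeeping] -/
theorem keyA₁₃_mem_badClass₁₃_determined (K : ℕ) (t : ℝ) (hj : jcut K < K₀ + K ∨ jcut K = 0)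
    (s₁ s₂ : SeqOfRecord F θ.ν θ.τ9.M (histA₁₃ θ K₀ g₀ K) (K₀ + K) (K₀ + K))
    (h : ∀ i, 1 ≤ i → i < K₀ + K → s₁.Λ i = s₂.Λ i ∧ s₁.Ω i = s₂.Ω i) :
    keyA₁₃ θ K₀ g₀ K s₁ ∈ badClass₁₃ θ K₀ g₀ jcut K t ↔ keyA₁₃ θ K₀ g₀ K s₂ ∈ badClass₁₃ θ K₀ g₀ jcut K t := by
  rw [keyA₁₃_mem_badClass₁₃_iff_exists, keyA₁₃_mem_badClass₁₃_iff_exists]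
  refine exists_congr fun j => ⟨fun ⟨h1, h2, h3⟩ => ⟨h1, h2, ?_⟩, fun ⟨h1, h2, h3⟩ => ⟨h1, h2, ?_⟩⟩
  · have hjK : j < K₀ + K := by rcases hj with hj | hj <;> omega
    rwa [← (h j h1 hjK).1]
  · have hjK : j < K₀ + K := by rcases hj with hj | hj <;> omega
    rwa [(h j h1 hjK).1]

/-- run B: for `jcut K < K₀ + K` (or `jcut K = 0`), bad membership of `keyB₁₃ … s′` is DETERMINED BELOW RUN B's TOP `K₀ + K + 1` — at `M = 0` the key is the constant junk key.
[bookkeeping] -/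
theorem keyB₁₃_mem_badClass₁₃_determined (K : ℕ) (t : ℝ) (hj : jcut K < K₀ + K ∨ jcut K = 0)
    (s₁ s₂ : SeqOfRecord F θ.ν θ.τ9.M (histB₁₃ θ K₀ g₀ K) (K₀ + K + 1) (K₀ + K + 1))
    (h : ∀ i, 1 ≤ i → i < K₀ + K + 1 → s₁.Λ i = s₂.Λ i ∧ s₁.Ω i = s₂.Ω i) :
    keyB₁₃ θ K₀ g₀ K s₁ ∈ badClass₁₃ θ K₀ g₀ jcut K t ↔ keyB₁₃ θ K₀ g₀ K s₂ ∈ badClass₁₃ θ K₀ g₀ jcut K t := by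
  by_cases hM : 0 < θ.τ9.M
  · have hj' : jcut K ≤ K₀ + K := by rcases hj with hj | hj <;> omega
    rw [keyB₁₃_mem_badClass₁₃_iff_exists θ K₀ g₀ jcut hM K t hj', keyB₁₃_mem_badClass₁₃_iff_exists θ K₀ g₀ jcut hM K t hj']
    refine exists_congr fun j => ⟨fun ⟨h1, h2, h3⟩ => ⟨h1, h2, ?_⟩, fun ⟨h1, h2, h3⟩ => ⟨h1, h2, ?_⟩⟩
    · have hjK : j + 1 < K₀ + K + 1 := by rcases hj with hj | hj <;> omega
      rwa [← (h (j + 1) (by omega) hjK).1]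
    · have hjK : j + 1 < K₀ + K + 1 := by rcases hj with hj | hj <;> omega
      rwa [(h (j + 1) (by omega) hjK).1]
  · have hc : keyB₁₃ θ K₀ g₀ K s₁ = keyB₁₃ θ K₀ g₀ K s₂ := by simp [keyB₁₃, hM]
    rw [hc]

/-- ★★★ **THE BAD-CLASS SUM OF RUN A's GAPPED WEIGHTS DOES NOT DEPEND ON THE DIALS** (policy `jcut K < K₀ + K`, or `jcut K = 0`): on the live-selector line, under (H-ζ),
`Σ_{x ∈ Bad_K(t)} gapWeightA₁₃ … ρ n K t x = Σ_{x ∈ Bad_K(t)} gapWeightA₁₃ … ρ′ n′ K t x` for ANY `(ρ, n)`, `(ρ′, n′)` — the persistence class is decided below the top, where the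
top-lettered terms re-sum letter-free (§47).  N20's target is not moved by the dials. [bookkeeping] -/
theorem sum_badClass₁₃_gapWeightA₁₃_letter_free (E : B12.RunParams → ℝ) (hsel : θ.ppSel = ppSelLiveOfRecord F N θ.ν θ.τ9 E (wOfRecord₉ F N θ.toStage9Params))
    (hζm : ZetaMeasurable F N θ.ζ) (ρ : ℕ → ℝ) (n : ℕ → ℕ) (ρ' : ℕ → ℝ) (n' : ℕ → ℕ) (K : ℕ) (t : ℝ) (hj : jcut K < K₀ + K ∨ jcut K = 0) :
    ∑ x ∈ badClass₁₃ θ K₀ g₀ jcut K t, gapWeightA₁₃ θ hP K₀ g₀ os ρ n K t x = ∑ x ∈ badClass₁₃ θ K₀ g₀ jcut K t, gapWeightA₁₃ θ hP K₀ g₀ os ρ' n' K t x := by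
  letI : ∀ Kc, DecidableEq (SiteSeqKey F Kc) := fun _ => Classical.decEq _
  have hζ0 : ∀ p g k s Pl Ql RS U V', 0 ≤ θ.ζ p g k s Pl Ql RS U V' :=
    fun p g k s Pl Ql RS U V' => zetaOfRecord_nonneg F N θ.ν θ.τ9.M hP.zetaUnity hP.zetaAbs p g k s Pl Ql RS U V'
  have hU : LocalBgMeasurable F N θ.ν := localBgMeasurable F N θ.ν
  have hD : (datumOfRecord₁₃CoPH F N θ hP).AvgMeasurable := (isPrintedAveraged_datumOfRecord₁₃CoPH F N θ hP).avgMeasurable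
  rw [sum_badClass₁₃_gapWeightA₁₃_eq_sum_filter, sum_badClass₁₃_gapWeightA₁₃_eq_sum_filter]
  refine sum_filter_topTermAtLevel_letter_free F N θ.toStage9Params (datumOfRecord₁₃CoPH F N θ hP) g₀ os (runA₁₃ F K₀ g₀ K) (histA₁₃ θ K₀ g₀ K)
    hζm hP.zetaAbs hP.zetaUnity t
    (fun k _ s => integrable_chi_mul_dressedSlots_of_ppSelLive θ.toStage9Params E hsel hU hζm hζ0 hP.zetaAbs _ hD g₀ os (histA₁₃_zero θ K₀ g₀ K) t k s)
    (K₀ + K) rfl (fun s => keyA₁₃ θ K₀ g₀ K s ∈ badClass₁₃ θ K₀ g₀ jcut K t) (fun _ s₁ s₂ h => ?_) _ _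
  exact keyA₁₃_mem_badClass₁₃_determined θ K₀ g₀ jcut K t hj s₁ s₂ h

/-- ★★★ **… AND OF RUN B's.** [bookkeeping] -/
theorem sum_badClass₁₃_gapWeightB₁₃_letter_free (E : B12.RunParams → ℝ) (hsel : θ.ppSel = ppSelLiveOfRecord F N θ.ν θ.τ9 E (wOfRecord₉ F N θ.toStage9Params))
    (hζm : ZetaMeasurable F N θ.ζ) (ρ : ℕ → ℝ) (n : ℕ → ℕ) (ρ' : ℕ → ℝ) (n' : ℕ → ℕ) (K : ℕ) (t : ℝ) (hj : jcut K < K₀ + K ∨ jcut K = 0) :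
    ∑ x ∈ badClass₁₃ θ K₀ g₀ jcut K t, gapWeightB₁₃ θ hP K₀ g₀ os ρ n K t x = ∑ x ∈ badClass₁₃ θ K₀ g₀ jcut K t, gapWeightB₁₃ θ hP K₀ g₀ os ρ' n' K t x := by
  letI : ∀ Kc, DecidableEq (SiteSeqKey F Kc) := fun _ => Classical.decEq _
  have hζ0 : ∀ p g k s Pl Ql RS U V', 0 ≤ θ.ζ p g k s Pl Ql RS U V' :=
    fun p g k s Pl Ql RS U V' => zetaOfRecord_nonneg F N θ.ν θ.τ9.M hP.zetaUnity hP.zetaAbs p g k s Pl Ql RS U V'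
  have hU : LocalBgMeasurable F N θ.ν := localBgMeasurable F N θ.ν
  have hD : (datumOfRecord₁₃CoPH F N θ hP).AvgMeasurable := (isPrintedAveraged_datumOfRecord₁₃CoPH F N θ hP).avgMeasurable
  rw [sum_badClass₁₃_gapWeightB₁₃_eq_sum_filter, sum_badClass₁₃_gapWeightB₁₃_eq_sum_filter]
  refine sum_filter_topTermAtLevel_letter_free F N θ.toStage9Params (datumOfRecord₁₃CoPH F N θ hP) g₀ os (runB₁₃ F K₀ g₀ K) (histB₁₃ θ K₀ g₀ K)
    hζm hP.zetaAbs hP.zetaUnity t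
    (fun k _ s => integrable_chi_mul_dressedSlots_of_ppSelLive θ.toStage9Params E hsel hU hζm hζ0 hP.zetaAbs _ hD g₀ os (histB₁₃_zero θ K₀ g₀ K) t k s)
    (K₀ + K + 1) rfl (fun s' => keyB₁₃ θ K₀ g₀ K s' ∈ badClass₁₃ θ K₀ g₀ jcut K t) (fun _ s₁ s₂ h => ?_) _ _
  exact keyB₁₃_mem_badClass₁₃_determined θ K₀ g₀ jcut K t hj s₁ s₂ h

/-- ★★★ **`RelWeightBound` AT THE GAPPED CARRIERS IS ONE STATEMENT FOR ALL DIALS** (policies with `jcut K < K₀ + K ∨ jcut K = 0` for every `K`; live-selector line; (H-ζ)): for every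
weight sequence `W`, `RelWeightBound 1 (classSet₁₃ …) (gapWeightA₁₃ … ρ n) (gapWeightB₁₃ … ρ n) (badClass₁₃ … jcut) W ↔` the same at `(ρ′, n′)` — in particular N20's face on the
gapped road equals its `ρ′ ≡ 0` instance (the `ε`-lettered PRE-𝐑 top terms; R4 `cutGrid_width_zero`).  N20's face itself is NOT proved; nothing of Bałaban's asserted. [bookkeeping] -/
theorem relWeightBound_gapCarriers_iff (E : B12.RunParams → ℝ) (hsel : θ.ppSel = ppSelLiveOfRecord F N θ.ν θ.τ9 E (wOfRecord₉ F N θ.toStage9Params))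
    (hζm : ZetaMeasurable F N θ.ζ) (hj : ∀ K, jcut K < K₀ + K ∨ jcut K = 0) (ρ : ℕ → ℝ) (n : ℕ → ℕ) (ρ' : ℕ → ℝ) (n' : ℕ → ℕ) (W : ℕ → ℝ) :
    RelWeightBound 1 (classSet₁₃ θ K₀ g₀) (gapWeightA₁₃ θ hP K₀ g₀ os ρ n) (gapWeightB₁₃ θ hP K₀ g₀ os ρ n) (badClass₁₃ θ K₀ g₀ jcut) W ↔
      RelWeightBound 1 (classSet₁₃ θ K₀ g₀) (gapWeightA₁₃ θ hP K₀ g₀ os ρ' n') (gapWeightB₁₃ θ hP K₀ g₀ os ρ' n') (badClass₁₃ θ K₀ g₀ jcut) W := by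
  have hA : ∀ K t, ∑ x ∈ badClass₁₃ θ K₀ g₀ jcut K t, gapWeightA₁₃ θ hP K₀ g₀ os ρ n K t x =
      ∑ x ∈ badClass₁₃ θ K₀ g₀ jcut K t, gapWeightA₁₃ θ hP K₀ g₀ os ρ' n' K t x :=
    fun K t => sum_badClass₁₃_gapWeightA₁₃_letter_free θ hP K₀ g₀ os jcut E hsel hζm ρ n ρ' n' K t (hj K)
  have hB : ∀ K t, ∑ x ∈ badClass₁₃ θ K₀ g₀ jcut K t, gapWeightB₁₃ θ hP K₀ g₀ os ρ n K t x =
      ∑ x ∈ badClass₁₃ θ K₀ g₀ jcut K t, gapWeightB₁₃ θ hP K₀ g₀ os ρ' n' K t x :=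
    fun K t => sum_badClass₁₃_gapWeightB₁₃_letter_free θ hP K₀ g₀ os jcut E hsel hζm ρ n ρ' n' K t (hj K)
  have hZA : ∀ K t, ∑ x ∈ classSet₁₃ θ K₀ g₀ K, gapWeightA₁₃ θ hP K₀ g₀ os ρ n K t x = ∑ x ∈ classSet₁₃ θ K₀ g₀ K, gapWeightA₁₃ θ hP K₀ g₀ os ρ' n' K t x :=
    fun K t => by rw [sum_classSet₁₃_gapWeightA₁₃_eq_schemeZ K₀ θ hP g₀ os E hsel hζm, sum_classSet₁₃_gapWeightA₁₃_eq_schemeZ K₀ θ hP g₀ os E hsel hζm]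
  have hZB : ∀ K t, ∑ x ∈ classSet₁₃ θ K₀ g₀ K, gapWeightB₁₃ θ hP K₀ g₀ os ρ n K t x = ∑ x ∈ classSet₁₃ θ K₀ g₀ K, gapWeightB₁₃ θ hP K₀ g₀ os ρ' n' K t x :=
    fun K t => by rw [sum_classSet₁₃_gapWeightB₁₃_eq_schemeZ K₀ θ hP g₀ os E hsel hζm, sum_classSet₁₃_gapWeightB₁₃_eq_schemeZ K₀ θ hP g₀ os E hsel hζm]
  constructor
  · intro h
    exact
      { bad_subset := h.bad_subset
        nonneg := h.nonneg
        lt_one := h.lt_one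
        summable := h.summable
        bad_left := fun K t ht => by rw [← hA, ← hZA]; exact h.bad_left K t ht
        bad_right := fun K t ht => by rw [← hB, ← hZB]; exact h.bad_right K t ht }
  · intro h
    exact
      { bad_subset := h.bad_subset
        nonneg := h.nonneg
        lt_one := h.lt_one
        summable := h.summable
        bad_left := fun K t ht => by rw [hA, hZA]; exact h.bad_left K t ht
        bad_right := fun K t ht => by rw [hB, hZB]; exact h.bad_right K t ht }

end Record

end Summit.QuantumFields.YangMills.Theorems.N21ShellSplitOfRecord13CoPH

end
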